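import Summits.CriticalPhenomena.PercolationContinuityZ3.Theorems.SahiMasterFamilyRepresentativeForm
import Summits.CriticalPhenomena.PercolationContinuityZ3.Theorems.SahiMasterFamilyStrictHierarchyPairs

/-!
# Strictness of Sahi's hierarchy at every order, II: `E_n` of an indicator family on LIGHT ATOMS — the expansion in the
# number of distinct representatives and its tail bound

Support file of the master-family programme (crux `NoHeavyLowerTail`, stmt-CriticalPhenomena-4575; cell `prim-masterthm`,
seat P4, unit `prim-masterthm-p4-g4`).  Generic in the finite type `α` and the real weight `μ`; no poset yet.

From the representative form (`SahiRepresentativeForm.sahiE_setInd_eq_sum_piFinset`)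
`E_{n+1}(1_{U_0},…,1_{U_n}) = (−1)^n Σ_{γ ∈ ∏ U_i} ∏_x (μ x)^{(occ γ x)}` and the sign of a falling factorial on `[0,1]`
(`descPochhammer_eval_succ`: `(x)^{(m+1)} = (−1)^m · x·∏_{u<m}(u+1−x)`), every system of representatives `γ` with `r`
distinct values contributes `(−1)^{r+1}·M(γ)` with `M(γ) = ∏_{a ∈ im γ} ffm (μ a) (occ γ a − 1) ≥ 0`
(`sahiE_setInd_eq_sum_sign`).  If every atom of every `U_i` has mass in `[0, δ]`, `δ ≤ 1`, then `M(γ) ≤ δ^r (n+1)!`, so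

  `S₁ − S₂ − T ≤ E_{n+1}(U) ≤ S₁ − S₂ + T`,  `T = #(∏U_i)·δ³·(n+1)!`   (`sahiE_setInd_ge`, `sahiE_setInd_le`),

where `S₁ = sumOne = Σ_{r(γ)=1} M` and `S₂ = sumTwo = Σ_{r(γ)=2} M`; their structure (constant systems; two-valued systems
↔ ordered pairs of atoms × rooted admissible splits, `SahiPairFunctional.radm`) is the companion file
`SahiMasterFamilyLightAtomsPairs`.
HONEST FRAMING: elementary estimates; [this work].  Used by `SahiMasterFamilyStrictHierarchy`.
-/

namespace Summit.CriticalPhenomena.PercolationContinuityZ3.Theorems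

namespace SahiLightAtoms

open Finset Function Polynomial
open Literature.Combinatorics.Sahi2008 SahiRepresentativeForm SahiPairFunctional

variable {α : Type*} [Fintype α] [DecidableEq α]

/-! ### Falling factorials on `[0,1]`: sign and magnitude -/

/-- The magnitude of `(x)^{(m+1)}` for `x ∈ [0,1]`: `x · ∏_{u<m} (u + 1 − x)`. [this work] -/
noncomputable def ffm (x : ℝ) (m : ℕ) : ℝ := x * ∏ u ∈ range m, ((u : ℝ) + 1 - x)

omit [Fintype α] [DecidableEq α] in
/-- `(x)^{(m+1)} = (−1)^m · ffm x m`. [this work] -/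
theorem descPochhammer_eval_succ (x : ℝ) (m : ℕ) :
    (descPochhammer ℝ (m + 1)).eval x = (-1) ^ m * ffm x m := by
  induction m with
  | zero => simp [ffm, descPochhammer_one]
  | succ m ih =>
    rw [descPochhammer_succ_eval, ih, ffm, ffm, prod_range_succ, pow_succ]
    push_cast
    ring

omit [Fintype α] [DecidableEq α] in
/-- `∏_{u<m} (u+1) = m!` in `ℝ`. [folklore] -/
theorem prod_range_add_one_real (m : ℕ) : ∏ u ∈ range m, ((u : ℝ) + 1) = (m.factorial : ℝ) := by
  rw [← Finset.prod_range_add_one_eq_factorial]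
  push_cast
  rfl

omit [Fintype α] [DecidableEq α] in
/-- `ffm x m ≥ 0` on `[0,1]`. [this work] -/
theorem ffm_nonneg {x : ℝ} (hx0 : 0 ≤ x) (hx1 : x ≤ 1) (m : ℕ) : 0 ≤ ffm x m :=
  mul_nonneg hx0 (prod_nonneg fun u _ => by have := (u : ℕ).cast_nonneg (α := ℝ); linarith)

omit [Fintype α] [DecidableEq α] in
/-- `ffm x m ≤ x·m!` on `[0,1]`. [this work] -/
theorem ffm_le {x : ℝ} (hx0 : 0 ≤ x) (hx1 : x ≤ 1) (m : ℕ) : ffm x m ≤ x * m.factorial := by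
  unfold ffm
  refine mul_le_mul_of_nonneg_left ?_ hx0
  rw [← prod_range_add_one_real]
  refine prod_le_prod (fun u _ => ?_) (fun u _ => ?_)
  · have := (u : ℕ).cast_nonneg (α := ℝ); linarith
  · linarith

omit [Fintype α] [DecidableEq α] in
/-- `ffm x m ≥ x·m!·(1 − m·x)` on `[0,1]` (Bernoulli). [this work] -/
theorem ffm_ge {x : ℝ} (hx0 : 0 ≤ x) (hx1 : x ≤ 1) (m : ℕ) : x * (m.factorial * (1 - m * x)) ≤ ffm x m := by
  unfold ffm
  refine mul_le_mul_of_nonneg_left ?_ hx0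
  have hbern : 1 - (m : ℝ) * x ≤ (1 - x) ^ m := by
    have := one_add_mul_le_pow (show (-2 : ℝ) ≤ -x by linarith) m
    simpa [sub_eq_add_neg, mul_neg, mul_comm] using this
  calc (m.factorial : ℝ) * (1 - m * x) ≤ m.factorial * (1 - x) ^ m :=
        mul_le_mul_of_nonneg_left hbern (Nat.cast_nonneg _)
    _ = ∏ u ∈ range m, (((u : ℝ) + 1) * (1 - x)) := by
        rw [prod_mul_distrib, prod_const, card_range, prod_range_add_one_real]
    _ ≤ ∏ u ∈ range m, ((u : ℝ) + 1 - x) := by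
        refine prod_le_prod (fun u _ => ?_) (fun u _ => ?_)
        · have := (u : ℕ).cast_nonneg (α := ℝ); nlinarith
        · have := (u : ℕ).cast_nonneg (α := ℝ); nlinarith

/-! ### The magnitude `M(γ)` and the sign split of the representative weight -/

/-- `M(γ) = ∏_{a ∈ im γ} ffm (μ a) (occ γ a − 1)`. [this work] -/
noncomputable def absWeight (μ : α → ℝ) {n : ℕ} (γ : Fin n → α) : ℝ :=
  ∏ a ∈ univ.image γ, ffm (μ a) (occ γ a - 1)

omit [Fintype α] in
/-- Off the image the occupation number vanishes. [this work] -/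
theorem occ_eq_zero_of_not_mem_image {n : ℕ} (γ : Fin n → α) {x : α} (hx : x ∉ univ.image γ) : occ γ x = 0 := by
  rw [occ, card_eq_zero, filter_eq_empty_iff]
  intro i _ hi
  exact hx (mem_image.2 ⟨i, mem_univ _, hi⟩)

omit [Fintype α] in
/-- On the image the occupation number is positive. [this work] -/
theorem occ_pos_of_mem_image {n : ℕ} (γ : Fin n → α) {x : α} (hx : x ∈ univ.image γ) : 0 < occ γ x := by
  obtain ⟨i, -, hi⟩ := mem_image.1 hx
  exact card_pos.2 ⟨i, by simp [hi]⟩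

omit [Fintype α] in
/-- A map out of `Fin (n+1)` has a nonempty image. [folklore] -/
theorem card_image_pos {n : ℕ} (γ : Fin (n + 1) → α) : 0 < (univ.image γ).card :=
  card_pos.2 (image_nonempty.2 univ_nonempty)

/-- `Σ_{a ∈ im γ} occ γ a = n`. [this work] -/
theorem sum_image_occ {n : ℕ} (γ : Fin n → α) : ∑ a ∈ univ.image γ, occ γ a = n := by
  rw [sum_subset (subset_univ _) fun x _ hx => occ_eq_zero_of_not_mem_image γ hx]
  exact sum_occ γ

/-- **Sign split**: `repWeight μ γ = (−1)^{n+1+r(γ)} · M(γ)` for `γ : Fin (n+1) → α`. [this work] -/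
theorem repWeight_eq_sign_mul_absWeight (μ : α → ℝ) {n : ℕ} (γ : Fin (n + 1) → α) :
    repWeight μ γ = (-1) ^ (n + 1 + (univ.image γ).card) * absWeight μ γ := by
  unfold repWeight absWeight
  rw [← prod_subset (subset_univ (univ.image γ)) fun x _ hx => by
    rw [occ_eq_zero_of_not_mem_image γ hx, descPochhammer_zero, eval_one]]
  have h : ∀ a ∈ univ.image γ, (descPochhammer ℝ (occ γ a)).eval (μ a) =
      (-1) ^ (occ γ a - 1) * ffm (μ a) (occ γ a - 1) := by
    intro a ha
    conv_lhs => rw [← Nat.sub_add_cancel (occ_pos_of_mem_image γ ha)]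
    exact descPochhammer_eval_succ (μ a) _
  rw [prod_congr rfl h, prod_mul_distrib, prod_pow_eq_pow_sum]
  congr 1
  have hsum : ∑ a ∈ univ.image γ, (occ γ a - 1) + (univ.image γ).card = n + 1 := by
    rw [card_eq_sum_ones, ← sum_add_distrib]
    exact (sum_congr rfl fun a ha => Nat.sub_add_cancel (occ_pos_of_mem_image γ ha)).trans (sum_image_occ γ)
  rw [show n + 1 + (univ.image γ).card = (∑ a ∈ univ.image γ, (occ γ a - 1)) + 2 * (univ.image γ).card by omega,
    pow_add, pow_mul, neg_one_sq, one_pow, mul_one]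

/-- **`E_{n+1}` of an indicator family as a signed sum of magnitudes**: each system of representatives with `r` distinct
values contributes `(−1)^{r+1} M(γ)`. [this work] -/
theorem sahiE_setInd_eq_sum_sign (μ : α → ℝ) (n : ℕ) (U : Fin (n + 1) → Finset α) :
    sahiE μ (n + 1) (fun i => setInd (U i)) =
      ∑ γ ∈ Fintype.piFinset U, (-1) ^ ((univ.image γ).card + 1) * absWeight μ γ := by
  rw [sahiE_setInd_eq_sum_piFinset, mul_sum]
  refine sum_congr rfl fun γ _ => ?_
  rw [repWeight_eq_sign_mul_absWeight, ← mul_assoc, ← pow_add]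
  congr 1
  rw [show n + (n + 1 + (univ.image γ).card) = ((univ.image γ).card + 1) + 2 * n by ring, pow_add, pow_mul,
    neg_one_sq, one_pow, mul_one]

/-! ### Bounds on `M(γ)` when the atoms are light -/

omit [Fintype α] in
/-- `M(γ) ≥ 0` when the image atoms have mass in `[0,1]`. [this work] -/
theorem absWeight_nonneg {μ : α → ℝ} {n : ℕ} {γ : Fin n → α} (h : ∀ a ∈ univ.image γ, 0 ≤ μ a ∧ μ a ≤ 1) :
    0 ≤ absWeight μ γ :=
  prod_nonneg fun a ha => ffm_nonneg (h a ha).1 (h a ha).2 _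

/-- `∏_{a ∈ im γ} (occ γ a − 1)! ≤ (n+1)!`. [this work] -/
theorem prod_factorial_occ_sub_one_le {n : ℕ} (γ : Fin (n + 1) → α) :
    ∏ a ∈ univ.image γ, (occ γ a - 1).factorial ≤ (n + 1).factorial := by
  calc ∏ a ∈ univ.image γ, (occ γ a - 1).factorial ≤ ∏ a ∈ univ.image γ, (occ γ a).factorial :=
        prod_le_prod' fun a _ => Nat.factorial_le (Nat.sub_le _ _)
    _ ≤ (∑ a ∈ univ.image γ, occ γ a).factorial :=
        Nat.le_of_dvd (Nat.factorial_pos _) (Nat.prod_factorial_dvd_factorial_sum _ _)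
    _ = (n + 1).factorial := by rw [sum_image_occ]

/-- `M(γ) ≤ δ^{r(γ)}·(n+1)!` when the image atoms have mass in `[0, δ]`, `0 ≤ δ ≤ 1`. [this work] -/
theorem absWeight_le {μ : α → ℝ} {n : ℕ} {γ : Fin (n + 1) → α} {δ : ℝ} (hδ0 : 0 ≤ δ) (hδ1 : δ ≤ 1)
    (h : ∀ a ∈ univ.image γ, 0 ≤ μ a ∧ μ a ≤ δ) :
    absWeight μ γ ≤ δ ^ (univ.image γ).card * (n + 1).factorial := by
  unfold absWeight
  calc ∏ a ∈ univ.image γ, ffm (μ a) (occ γ a - 1)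
      ≤ ∏ a ∈ univ.image γ, (δ * (occ γ a - 1).factorial) := by
        refine prod_le_prod (fun a ha => ffm_nonneg (h a ha).1 ((h a ha).2.trans hδ1) _) fun a ha => ?_
        calc ffm (μ a) (occ γ a - 1) ≤ μ a * (occ γ a - 1).factorial := ffm_le (h a ha).1 ((h a ha).2.trans hδ1) _
          _ ≤ δ * (occ γ a - 1).factorial := mul_le_mul_of_nonneg_right (h a ha).2 (Nat.cast_nonneg _)
    _ = δ ^ (univ.image γ).card * ∏ a ∈ univ.image γ, ((occ γ a - 1).factorial : ℝ) := by
        rw [prod_mul_distrib, prod_const]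
    _ ≤ δ ^ (univ.image γ).card * (n + 1).factorial := by
        refine mul_le_mul_of_nonneg_left ?_ (pow_nonneg hδ0 _)
        exact_mod_cast prod_factorial_occ_sub_one_le γ

/-! ### First- and second-order terms, tail -/

/-- The slots whose event contains the atom `a`. [this work] -/
def rows {n : ℕ} (U : Fin n → Finset α) (a : α) : Finset (Fin n) := univ.filter fun i => a ∈ U i

omit [Fintype α] in
/-- Membership in `rows`. [this work] -/
theorem mem_rows {n : ℕ} {U : Fin n → Finset α} {a : α} {i : Fin n} : i ∈ rows U a ↔ a ∈ U i := by
  simp [rows]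

/-- The first-order term `S₁ = Σ_{r(γ)=1} M(γ)`. [this work] -/
noncomputable def sumOne (μ : α → ℝ) {n : ℕ} (U : Fin n → Finset α) : ℝ :=
  ∑ γ ∈ (Fintype.piFinset U).filter (fun γ => (univ.image γ).card = 1), absWeight μ γ

/-- The second-order term `S₂ = Σ_{r(γ)=2} M(γ)`. [this work] -/
noncomputable def sumTwo (μ : α → ℝ) {n : ℕ} (U : Fin n → Finset α) : ℝ :=
  ∑ γ ∈ (Fintype.piFinset U).filter (fun γ => (univ.image γ).card = 2), absWeight μ γ

omit [Fintype α] in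
/-- Atoms met by a system of representatives of a light family are light. [this work] -/
theorem light_of_mem_piFinset {μ : α → ℝ} {n : ℕ} {U : Fin n → Finset α} {δ : ℝ}
    (hU : ∀ i, ∀ a ∈ U i, 0 ≤ μ a ∧ μ a ≤ δ) {γ : Fin n → α} (hγ : γ ∈ Fintype.piFinset U) :
    ∀ a ∈ univ.image γ, 0 ≤ μ a ∧ μ a ≤ δ := by
  intro a ha
  obtain ⟨i, -, rfl⟩ := mem_image.1 ha
  exact hU i _ (Fintype.mem_piFinset.1 hγ i)

/-- **The expansion to second order with tail bound**: for a light family (atoms of mass `≤ δ ≤ 1`),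
`|E_{n+1}(U) − (S₁ − S₂)| ≤ #(∏U_i)·δ³·(n+1)!`. [this work] -/
theorem abs_sahiE_setInd_sub_le (μ : α → ℝ) (n : ℕ) (U : Fin (n + 1) → Finset α) {δ : ℝ} (hδ0 : 0 ≤ δ)
    (hδ1 : δ ≤ 1) (hU : ∀ i, ∀ a ∈ U i, 0 ≤ μ a ∧ μ a ≤ δ) :
    |sahiE μ (n + 1) (fun i => setInd (U i)) - (sumOne μ U - sumTwo μ U)| ≤
      (Fintype.piFinset U).card * (δ ^ 3 * (n + 1).factorial) := by
  rw [sahiE_setInd_eq_sum_sign]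
  set S := Fintype.piFinset U with hS
  have hsplit : ∀ γ ∈ S, (-1 : ℝ) ^ ((univ.image γ).card + 1) * absWeight μ γ =
      (if (univ.image γ).card = 1 then absWeight μ γ else 0) - (if (univ.image γ).card = 2 then absWeight μ γ else 0)
        + (if 3 ≤ (univ.image γ).card then (-1 : ℝ) ^ ((univ.image γ).card + 1) * absWeight μ γ else 0) := by
    intro γ _
    have hpos := card_image_pos γ
    rcases Nat.lt_or_ge (univ.image γ).card 3 with h3 | h3
    · interval_cases hc : (univ.image γ).card
      · norm_num [hc]
      · norm_num [hc]
    · have h1 : (univ.image γ).card ≠ 1 := by omega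
      have h2 : (univ.image γ).card ≠ 2 := by omega
      simp [h1, h2, h3]
  rw [sum_congr rfl hsplit, sum_add_distrib, sum_sub_distrib, ← sum_filter, ← sum_filter, ← sum_filter]
  unfold sumOne sumTwo
  rw [show ∀ a b c : ℝ, a - b + c - (a - b) = c from fun a b c => by ring]
  calc |∑ γ ∈ S.filter (fun γ => 3 ≤ (univ.image γ).card), (-1 : ℝ) ^ ((univ.image γ).card + 1) * absWeight μ γ|
      ≤ ∑ γ ∈ S.filter (fun γ => 3 ≤ (univ.image γ).card), |(-1 : ℝ) ^ ((univ.image γ).card + 1) * absWeight μ γ| :=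
        abs_sum_le_sum_abs _ _
    _ ≤ ∑ γ ∈ S.filter (fun γ => 3 ≤ (univ.image γ).card), δ ^ 3 * ((n + 1).factorial : ℝ) := by
        refine sum_le_sum fun γ hγ => ?_
        rw [mem_filter] at hγ
        have hl := light_of_mem_piFinset hU hγ.1
        rw [abs_mul, abs_pow, abs_neg, abs_one, one_pow, one_mul,
          abs_of_nonneg (absWeight_nonneg fun a ha => ⟨(hl a ha).1, (hl a ha).2.trans hδ1⟩)]
        calc absWeight μ γ ≤ δ ^ (univ.image γ).card * (n + 1).factorial := absWeight_le hδ0 hδ1 hl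
          _ ≤ δ ^ 3 * (n + 1).factorial :=
            mul_le_mul_of_nonneg_right (pow_le_pow_of_le_one hδ0 hδ1 hγ.2) (Nat.cast_nonneg _)
    _ = (S.filter (fun γ => 3 ≤ (univ.image γ).card)).card * (δ ^ 3 * (n + 1).factorial) := by
        rw [sum_const, nsmul_eq_mul]
    _ ≤ S.card * (δ ^ 3 * (n + 1).factorial) :=
        mul_le_mul_of_nonneg_right (by exact_mod_cast card_filter_le _ _)
          (mul_nonneg (pow_nonneg hδ0 _) (Nat.cast_nonneg _))

/-- **Lower estimate**: `E_{n+1}(U) ≥ S₁ − S₂ − #(∏U_i)·δ³·(n+1)!` for a light family. [this work] -/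
theorem sahiE_setInd_ge (μ : α → ℝ) (n : ℕ) (U : Fin (n + 1) → Finset α) {δ : ℝ} (hδ0 : 0 ≤ δ) (hδ1 : δ ≤ 1)
    (hU : ∀ i, ∀ a ∈ U i, 0 ≤ μ a ∧ μ a ≤ δ) :
    sumOne μ U - sumTwo μ U - (Fintype.piFinset U).card * (δ ^ 3 * (n + 1).factorial) ≤
      sahiE μ (n + 1) (fun i => setInd (U i)) := by
  have := (abs_le.1 (abs_sahiE_setInd_sub_le μ n U hδ0 hδ1 hU)).1
  linarith

/-- **Upper estimate**: `E_{n+1}(U) ≤ S₁ − S₂ + #(∏U_i)·δ³·(n+1)!` for a light family. [this work] -/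
theorem sahiE_setInd_le (μ : α → ℝ) (n : ℕ) (U : Fin (n + 1) → Finset α) {δ : ℝ} (hδ0 : 0 ≤ δ) (hδ1 : δ ≤ 1)
    (hU : ∀ i, ∀ a ∈ U i, 0 ≤ μ a ∧ μ a ≤ δ) :
    sahiE μ (n + 1) (fun i => setInd (U i)) ≤
      sumOne μ U - sumTwo μ U + (Fintype.piFinset U).card * (δ ^ 3 * (n + 1).factorial) := by
  have := (abs_le.1 (abs_sahiE_setInd_sub_le μ n U hδ0 hδ1 hU)).2
  linarith

end SahiLightAtoms

end Summit.CriticalPhenomena.PercolationContinuityZ3.Theorems
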